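import Summits.HodgeConjecture.HodgeConjecture.Theorems.K2E3HermitianWittBasis
import Literature.NumberTheory.Automorphic.Liu2021.LemD1IsotropyOfPlace
import HarnessLib

/-!
# K2 ∕ E3 «EllipticInputs», 13a road A, helper J4 (i)-arith: the anisotropic kernel of a hermitian space over `E_v = E ⊗_F F_v` has
# dimension `≤ 2`, and the Witt normal form `ᵗ(σT)·J_v·T = W♭(r, H_an)` with `N = 2r + m`, `m ≤ 2`, at every non-split place

Cell `hodgecm-mathlib` (Track B «K2-LIT»), item h413 = `stmt-HodgeConjecture-24833`; author K2E3-p10 (g2); count-neutral helper for the 13a line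
(road A, K2E3-p13 MEMO `MEMO-13a-admissibility-generalN` §5 «J4 (i): a similitude `ᵗ(σT)·H_w·T = a • wittForm r H_an` (`H_an` anisotropic, dim ≤ 2)»).
PROOF lane: theorems only (no `def`, no `instance`, no `sorry`), over ★ `K2E3HermitianWittBasis` (the Witt normal form over a field) and the tree's
local model `UnitaryGroup.LocalRing E v = Π_{w ∣ v} E_w` with `conjLocal`, the trace-form road of ★ `Liu2021/LemD1IsotropyOfPlace` (u-invariant `4`).

* §1 **`exists_isotropic_of_three_le`** — for ANY `σ_v`-hermitian `G ∈ M_m(E_v)` with `det G` a unit and `m ≥ 3` (a LOCAL Gram matrix, not only `J ⊗ 1`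
  of a global `J`), `hermForm (c ⊗ 1) G` has a non-zero isotropic vector: the trace form `x ↦ Tr_{E_v/F_v} h(x,x)` is an `F_v`-quadratic form in `2m ≥ 6`
  variables (★ `OscillatorStandingData.exists_quadraticForm_trace_form` on an inline standing datum), isotropic by ★
  `QuadraticForms.not_anisotropic_of_five_le_finrank_adicCompletion`, and a zero of the trace form is a zero of `h` (★ `exists_toLocalRing_eq_of_conjLocal_eq`,
  ★ `trace_toLocalRing`).  [cite: MoeglinVignerasWaldspurger1987, Chap. 1 I.1] [cite: Lam2005, Ch. VI Thm 2.12]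
* §2 `isUnit_det_of_anisotropic` (an anisotropic hermitian matrix over a field is non-degenerate) and **`finrank_anisotropic_le_two`**-type conclusion packaged as
  **`exists_GL_formCongr_eq_wittMatrix_rev_le_two`**: at a place `v` with `E_v` a field (the non-split places), for `J ∈ M_N(E)` hermitian with `det J ≠ 0`,
  `ᵗ(σ_v T) · J_v · T = reindex e e W♭(r, H_an)` with `H_an` anisotropic `σ_v`-hermitian of size `m ≤ 2` and `2r + m = N` — the local WITT INDEX is
  `r = ⌊N∕2⌋` or `N∕2 − 1`; for odd `N` always `m = 1` (quasi-split), for even `N` the two classes `m ∈ {0, 2}`.  [cite: Dieudonne1971GroupesClassiques, Chap. I §11]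
  [cite: Jacobowitz1962, Thm. 3.1]

References: C. Mœglin, M.-F. Vignéras, J.-L. Waldspurger, LNM 1291 (1987), Chap. 1 I.1; T. Y. Lam, *Introduction to quadratic forms over fields* (2005), VI.2.12;
R. Jacobowitz, *Hermitian forms over local fields*, Amer. J. Math. 84 (1962), Thm. 3.1; J. Dieudonné, *La géométrie des groupes classiques* (1971), I §11.
-/

set_option autoImplicit false
set_option linter.dupNamespace false

noncomputable section

namespace Summit.HodgeConjecture.HodgeConjecture.Cruxes.H413.K2E3LocalHermitianWittIndex

open NumberField IsDedekindDomain
open Literature.NumberTheory.Automorphic Literature.NumberTheory.Automorphic.UnitaryGroup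
open Literature.NumberTheory.Automorphic.Liu2021.LemD1OfPlace
open Literature.RepresentationTheory.Liu2021 (OscillatorStandingData)
open K2E3HermitianWittBasis
open scoped Matrix MatrixGroups

variable {F : Type} (E : Type) [Field F] [NumberField F] [Field E] [NumberField E] [Algebra F E]
  [Algebra.IsQuadraticExtension F E] (c : E ≃ₐ[F] E) (v : HeightOneSpectrum (𝓞 F)) {δ : E} (hcδ : c δ = -δ) (hδ : δ ≠ 0)

/-! ## §1 Hermitian spaces of rank `≥ 3` over `E_v` are isotropic (any local Gram matrix) -/

include hcδ hδ in
/-- **A `σ_v`-hermitian Gram matrix `G ∈ M_m(E_v)` with `det G` a unit and `m ≥ 3` has a non-zero isotropic vector** (trace form over `F_v` in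
`2m ≥ 6` variables + u-invariant `4`). [cite: MoeglinVignerasWaldspurger1987, Chap. 1 I.1] [cite: Lam2005, Ch. VI Thm 2.12] -/
theorem exists_isotropic_of_three_le {m : ℕ} (hm : 3 ≤ m) (G : Matrix (Fin m) (Fin m) (LocalRing E v))
    (hG : (G.map (conjLocal E c v))ᵀ = G) (hGd : IsUnit G.det) :
    ∃ x : Fin m → LocalRing E v, x ≠ 0 ∧ hermForm (conjLocal E c v) G x x = 0 := by
  haveI : CharZero (v.adicCompletion F) := charZero_of_injective_algebraMap (algebraMap F _).injective
  let S : OscillatorStandingData (v.adicCompletion F) (LocalRing E v) m :=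
    { conj := conjAlgEquiv E v c hcδ hδ
      conj_conj := conjLocal_conjLocal_apply E v c hcδ hδ
      conj_ne_refl := conjAlgEquiv_ne_refl E v c hcδ hδ
      gram := G
      gram_hermitian := hG
      isUnit_det_gram := hGd
      ringChar_ne_two := ringChar_adicCompletion_ne_two v
      formallyEtale := formallyEtale_localRing E v
      finrank_eq_two := finrank_localRing E v
      two_le := le_trans (by norm_num) hm }
  have hform : ∀ x y, S.form x y = hermForm (conjLocal E c v) G x y := fun x y => rfl
  obtain ⟨Q, hQ⟩ := S.exists_quadraticForm_trace_form
  have hnot : ¬ Q.Anisotropic :=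
    Literature.NumberTheory.QuadraticForms.not_anisotropic_of_five_le_finrank_adicCompletion F v Q
      (five_le_finrank_pi_localRing E v hm)
  unfold QuadraticMap.Anisotropic at hnot
  push Not at hnot
  obtain ⟨x, hQx, hx0⟩ := hnot
  refine ⟨x, hx0, ?_⟩
  -- a zero of the trace form is a zero of `h`: `h(x,x)` is `c ⊗ 1`-fixed, hence `= ι_v p` with `Tr (ι_v p) = 2p`
  have htr : Algebra.trace (v.adicCompletion F) (LocalRing E v) (S.form x x) = 0 := by rw [← hQ]; exact hQx
  have hfix : conjLocal E c v (S.form x x) = S.form x x := S.conj_form_self x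
  obtain ⟨p, hp⟩ := exists_toLocalRing_eq_of_conjLocal_eq E v c hcδ hδ _ hfix
  rw [← hp, trace_toLocalRing] at htr
  rw [← hform, ← hp, (mul_eq_zero.1 htr).resolve_left two_ne_zero, map_zero]

/-! ## §2 The Witt normal form with anisotropic kernel of rank `≤ 2` at the places where `E_v` is a field -/

omit [Algebra.IsQuadraticExtension F E] in
/-- An ANISOTROPIC hermitian matrix over `E_v` (a field) is non-degenerate: `det` is a unit (`σ_v` an involution). [folklore] -/
theorem isUnit_det_of_anisotropic (hE : IsField (LocalRing E v)) (hσ : ∀ a, conjLocal E c v (conjLocal E c v a) = a) {m : ℕ}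
    (G : Matrix (Fin m) (Fin m) (LocalRing E v)) (hanis : ∀ x : Fin m → LocalRing E v, hermForm (conjLocal E c v) G x x = 0 → x = 0) :
    IsUnit G.det := by
  letI : Field (LocalRing E v) := hE.toField
  rw [isUnit_iff_ne_zero]
  intro hdet
  obtain ⟨w, hw0, hw⟩ := Matrix.exists_vecMul_eq_zero_iff.2 hdet
  -- `x := σ ∘ w` pairs to zero with everything, hence is isotropic, hence zero
  set x : Fin m → LocalRing E v := fun i => conjLocal E c v (w i) with hxdef
  have hσx : (⇑(conjLocal E c v) ∘ x) = w := funext fun i => hσ (w i)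
  have hxx : hermForm (conjLocal E c v) G x x = 0 := by
    rw [hermForm_apply, hσx, Matrix.dotProduct_mulVec, hw, zero_dotProduct]
  have hx0 := hanis x hxx
  apply hw0
  funext i
  have hi : conjLocal E c v (w i) = 0 := congrFun hx0 i
  rw [← hσ (w i), hi, map_zero, Pi.zero_apply]

include hcδ hδ in
/-- **Witt normal form with anisotropic kernel of rank `≤ 2`.**  At a place `v` with `E_v` a field, for `J ∈ M_N(E)` hermitian with `det J ≠ 0` and
`J_v = (J ⊗ 1)` its local Gram matrix (★ `(adelicForm E N J).map (adeleToLocal E v)`): there are `r m` with `2r + m = N` and **`m ≤ 2`**, an index bijection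
`e`, `T ∈ GL_N(E_v)` and an anisotropic `σ_v`-hermitian `H_an ∈ M_m(E_v)` with `ᵗ(σ_v T)·J_v·T = reindex e e W♭(r, H_an)` (antidiagonal convention of
★ `exists_GL_formCongr_eq_wittMatrix_rev`). [cite: Dieudonne1971GroupesClassiques, Chap. I §11] [cite: Jacobowitz1962, Thm. 3.1] -/
theorem exists_GL_formCongr_eq_wittMatrix_rev_le_two (hE : IsField (LocalRing E v)) (N : ℕ) (J : Matrix (Fin N) (Fin N) E)
    (hJh : (J.map c)ᵀ = J) (hJdet : J.det ≠ 0) :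
    ∃ (r m : ℕ) (e : Fin r ⊕ (Fin m ⊕ Fin r) ≃ Fin N) (T : GL (Fin N) (LocalRing E v)) (Han : Matrix (Fin m) (Fin m) (LocalRing E v)),
      2 * r + m = N ∧ m ≤ 2 ∧ (Han.map (conjLocal E c v))ᵀ = Han ∧
      (∀ x : Fin m → LocalRing E v, hermForm (conjLocal E c v) Han x x = 0 → x = 0) ∧
      formCongr (conjLocal E c v) T ((adelicForm E N J).map (adeleToLocal E v)) = Matrix.reindex e e
        (Matrix.fromBlocks (0 : Matrix (Fin r) (Fin r) (LocalRing E v))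
          (Matrix.fromCols (0 : Matrix (Fin r) (Fin m) (LocalRing E v))
            (Matrix.of fun i j : Fin r => if i = Fin.rev j then (1 : LocalRing E v) else 0))
          (Matrix.fromRows (0 : Matrix (Fin m) (Fin r) (LocalRing E v))
            (Matrix.of fun i j : Fin r => if i = Fin.rev j then (1 : LocalRing E v) else 0))
          (Matrix.fromBlocks Han 0 0 (0 : Matrix (Fin r) (Fin r) (LocalRing E v)))) := by
  haveI : CharZero (v.adicCompletion F) := charZero_of_injective_algebraMap (algebraMap F _).injective
  have hσ : ∀ a, conjLocal E c v (conjLocal E c v a) = a := conjLocal_conjLocal_apply E v c hcδ hδ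
  have hJv : (((adelicForm E N J).map (adeleToLocal E v)).map (conjLocal E c v))ᵀ = (adelicForm E N J).map (adeleToLocal E v) :=
    localGram_hermitian E v c N J hJh
  have hJvd : IsUnit ((adelicForm E N J).map (adeleToLocal E v)).det := isUnit_det_localGram E v N J hJdet
  obtain ⟨r, m, e, T, Han, hcard, hHan, hanis, hW⟩ := by
    letI : Field (LocalRing E v) := hE.toField
    have h2 : (2 : LocalRing E v) ≠ 0 := by
      rw [show (2 : LocalRing E v) = algebraMap (v.adicCompletion F) (LocalRing E v) 2 by rw [map_ofNat]]
      exact (map_ne_zero (algebraMap (v.adicCompletion F) (LocalRing E v))).2 two_ne_zero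
    exact exists_GL_formCongr_eq_wittMatrix_rev (conjLocal E c v) ((adelicForm E N J).map (adeleToLocal E v)) hσ h2 hJv hJvd
  rw [Fintype.card_fin] at hcard
  refine ⟨r, m, e, T, Han, hcard, ?_, hHan, hanis, hW⟩
  -- the anisotropic kernel has rank `≤ 2`: otherwise §1 produces a non-zero isotropic vector
  by_contra hm
  obtain ⟨x, hx0, hxx⟩ := exists_isotropic_of_three_le E c v hcδ hδ (by omega) Han hHan (isUnit_det_of_anisotropic E c v hE hσ Han hanis)
  exact hx0 (hanis x hxx)

end Summit.HodgeConjecture.HodgeConjecture.Cruxes.H413.K2E3LocalHermitianWittIndex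

end
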